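import Literature.MathematicalPhysics.QuantumFieldTheory.Balaban1983to89.Node00.OpsYOfLetters
import Literature.MathematicalPhysics.QuantumFieldTheory.Balaban1983to89.B9Cor35ComparisonsGpC

/-!
# `Balaban1983to89.B9Cor35ComparisonsGpCAtLetters` — [B9] Cor. 3.5 (p. 407) AT NODE 00's OPERATOR LAYER OF LETTERS: the three `U = 1`
# comparisons `hGp_e`, `hGp_h1`, `hC` of the N06 knit PROVED at `ops := Node00.opsYOfLetters N θ M⋆ 𝔏 𝔈` — for EVERY letter record `𝔏`
# (def-Y's interface `Node00.CovLettersY`, carrying the printed `U = 1` clauses) — from the flatness fields `Gp_one`, `parS_one`, `C_one`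

T. Bałaban, *Propagators for lattice gauge theories in a background field*, Commun. Math. Phys. **99** (1985) 389–434
[`Balaban1985BackgroundPropagators`, "B9"]; [4] = T. Bałaban, *Propagators and renormalization transformations for lattice
gauge theories. II*, Commun. Math. Phys. **96** (1984) 223–250 [`Balaban1984PropagatorsII`].

statement-level skeleton of published theorems with citation tags; proofs where landed; nothing here is a claim about the
Yang–Mills mass gap

THE PRINTED LOCUS (p. 407, proof of Corollary 3.5, verbatim): *"For operators with the external gauge field configuration U = 1,
these theorems are proved in [4]"*; p. 395: *"It coincides with Δ_a in (2.19) if U = 1"*; Thm 3.1 (3.42)–(3.43) pp. 397–398, Thm 3.2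
(3.48) p. 398; [4] Prop. 2.2 (2.67) p. 234, Prop. 2.3 (2.86)–(2.87) p. 238.

THE POINT.  NODE 00's seat def-Y typed the operator layer of Stage 3′(Y) AS A FUNCTION OF BAŁABAN'S COVARIANT LETTERS
(`Node00.OpsYOfLetters`): the reading of a site-sector letter `O(U)` (G′(U)) is `Node00.kernelFamilyS` — product-form arguments `λ ⊗ E`
(`Node00.liftY`, `E` in the closed unit ball `Node00.BallY 𝔸`), the sup entries (3.42) as `η^{(2,1,1,0)}·sup_E` of NODE 00's block suprema
with `|·| ↦ ‖·‖` and the flat differences ↦ def-Y's genuine covariant lattice calculus `cdS ∕ cdsS ∕ lapS` ((3.3), (3.8), (3.23)), the Hölder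
slot (3.43) with the transporter `parS` of (3.40) (`hqS`, `hLatS`), ON the site summand and `0` OFF; the (3.48) kernel is
`Node00.siteKernelOfOp` (`sup_E ‖(C(U)(δ_{y′} ⊗ E))(y)‖` at the carrier blocks); the letter interface `Node00.CovLettersY x` carries the
printed `U = 1` clauses `Gp_one` (G′(1) acts on `λ ⊗ E` as the lift of NODE 00's `KTIdx.G = Δ′_a⁻¹` of [4]), `parS_one` (transporters `1`),
`C_one` (C(1) on `δ_{s′} ⊗ E` is `CinvTP(s, s′) • E`).  def-Y proved the pattern on ONE entry (`Node00.Gp_e0_one_le`) and left the rows to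
the comparison seats.  THIS FILE proves rows 1–3 of dag-lead's N06-ASSIGNMENT (the knit binders `hGp_e`, `hGp_h1`, `hC` of
`B9PinCarriersKLevelV1.b9LeafX_carriersY` ∕ `Summit.…N06AtRecord11CB10YZW.b9_main_of_up_view₁₁B10YZW_of_obligations`) AT THAT LAYER, for
every `𝔏`, `𝔈`:

* §1 product-form algebra: `liftY_sub_apply`, `real_smul_liftY_apply`, `norm_real_smul_ball_le`.
* §2 THE FLAT CALCULUS ON LIFTS (def-Y's `cdS_one ∕ cdsS_one` composed with [4]'s matrices): `dT_transpose_mulVec` (`∂_μᵀ f = f(· − e_μ) − f`),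
  `perLapT_mulVec_eq_sum_dT` (`−Δ_T = Σ_μ ∂_μᵀ∂_μ` on vectors), `cdS_one_liftY` (`∇_{1,μ}(g ⊗ E) = (∂_μ g) ⊗ E`), `cdsS_one_liftY`
  (`∇*_{1,μ}(g ⊗ E) = (∂_μᵀ g) ⊗ E`), `lapS_one_liftY` (`Δ_1(g ⊗ E) = (−Δ_T g) ⊗ E`).
* §3 AT A SITE-SECTOR LETTER `O` WITH THE FLATNESS CLAUSE (`hO : O 1 (f ⊗ E) = (G′f) ⊗ E`), every reading at `U = 1` is DOMINATED by T8's [4]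
  functional: `supBlkS_one_le` ∕ `supBlkS'_cdS_one_le` ∕ `supBlkS'_cdsS_one_le` ∕ `supBlkS_lapS_one_le` (the four (3.42) entries vs
  `KTIdx.e0 … e3`), `eLatS_one_le` (all four), `hqS_one_liftY_le` ((3.40) at trivial transport vs `hqTP`), `hLatS_one_le` ((3.43) vs `hHTP`).
* §4 AT A MEMBER, def-Y's layer `operatorLayerYOfLetters 𝔸 G x 𝔏 𝔈`: ★ `Gp_e_one_le` (all four entries, both summands), ★ `Gp_h1_one_le`,
  `Cinv_ker_nonneg`, ★ `Cinv_ker_one_le_abs`, ★ `Cinv_ker_one_abs_le`.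
* §5 AT THE RECORD `ops := opsYOfLetters N θ M⋆ 𝔏 𝔈`: ★★ `hGp_e_opsYOfLetters`, ★★ `hGp_h1_opsYOfLetters`, ★★ `hC_opsYOfLetters` — conclusions
  LITERALLY the knit binders `hGp_e` ∕ `hGp_h1` ∕ `hC` at that `ops`, NO residual hypothesis beyond the section variables `𝔏 𝔈` (the printed
  `U = 1` clauses are fields of `𝔏`).

HONEST SCOPE.  Rows 1–3 are DISCHARGED AT THE LAYER OF LETTERS: for every inhabitant `𝔏` of def-Y's interface the comparisons hold — this
is Cor. 3.5's «for U = 1 … proved in [4]» at the level of READINGS (norms of lifts vs absolute values; sup over the unit ball).  It is NOT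
the construction of Bałaban's letters over the member's domains (def-Y's successor item `lettersYOfRecord`), and nothing of print's estimates
is asserted; count-neutral; N06 NOT discharged; one finite lattice programme — nothing continuum, nothing about the mass gap.  Cell `pub-ymgap`
(HUMAN RULING D-0062), Track A node N06 [B9], N06-ASSIGNMENT v1 rows 1–3 (bundle F1) at def-Y's instance, seat `pub-ymgap-dag-n06-f`, 2026-08-26.
-/

noncomputable section

namespace Literature.MathematicalPhysics.QuantumFieldTheory.Balaban1983to89.B9Cor35ComparisonsGpCAtLetters

open B4TorusKernel.MultiPeriod (torusSupNorm torusSupNorm_nonneg)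
open B6MultiLevelTorusOperator (tshift unitVec shiftMat shiftMat_mulVec shiftMat_neg perLapT perLapT_mulVec tshift_tshift tshift_zero
  tshift_symm_apply one_le_N0)
open B6Prop22DerivMultiLevelTorus (dT dT_mulVec)
open B6Ineq2142KLevelV1 (β)
open B6KLevelCensusIndexV1 (KIdx)
open B6Prop22KLevelTorusCensus (KTIdx)
open B6Prop22KLevelTorusCensusEta (gpTP hHTP hqTP dGT GdT hqTP_nonneg nKT nKT_pos)
open B6Prop22KLevelCensusEta (epow)
open B6Prop23KLevelTorusCensus (CinvTP)
open B9Eq39Adjoint (R R_one)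
open B9PinMembersKLevelV1 (MemberY geo9Y bg9Y)
open B9PinCarriersKLevelV1 (OperatorLayerY)
open B7Prop2SpecialUnitary (specialUnitaryUnits)
open B9Cor35ComparisonsGpC (gp_e_nonneg_T8 gpTP_e_nonneg hHTP_nonneg GpU_e_inl GpU_e_inr GpU_h1_inl_inl GpU_h1_inl_inr GpU_h1_inr
  CinvU_ker_eq)
open Node00
open scoped Matrix

variable {d ℓ : ℕ} {hd : 1 ≤ d + 1} {hL : Odd (ℓ + 1) ∧ 1 < ℓ + 1} {b₀ b₁ : ℝ} {Mstar : ℕ}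
variable {𝔸 : Type} [NormedRing 𝔸] [NormedAlgebra ℂ 𝔸] [CompleteSpace 𝔸]

/-! ## §1 Product-form algebra -/

section LiftAlgebra

variable {X : Type}

omit [CompleteSpace 𝔸] in
/-- differences of a lift are the lift of the difference: `(g ⊗ E)(z′) − (g ⊗ E)(z) = (g z′ − g z) • E`.
[cite: Balaban1985BackgroundPropagators, (3.39) p.397 (𝔤-valued λ; bookkeeping)] -/
theorem liftY_sub_apply (g : X → ℝ) (E : 𝔸) (z z' : X) : liftY g E z' - liftY g E z = (((g z' - g z : ℝ)) : ℂ) • E := by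
  rw [liftY_apply, liftY_apply, ← sub_smul, Complex.ofReal_sub]

omit [CompleteSpace 𝔸] in
/-- real scalars pass into the lift: `c • (g ⊗ E)(z) = ((c·g) ⊗ E)(z)`. [cite: Balaban1985BackgroundPropagators, (3.39) p.397 (bookkeeping)] -/
theorem real_smul_liftY_apply (c : ℝ) (g : X → ℝ) (E : 𝔸) (z : X) :
    ((c : ℝ) : ℂ) • liftY g E z = liftY (fun w => c * g w) E z := by
  rw [liftY_apply, liftY_apply, smul_smul, Complex.ofReal_mul]

/-- `‖r • E‖ ≤ |r|` for `E` in the closed unit ball. [cite: Balaban1985BackgroundPropagators, Cor. 3.5 p.407 (U = 1 reduces to [4]; bookkeeping)] -/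
theorem norm_real_smul_ball_le (r : ℝ) (E : BallY 𝔸) : ‖((r : ℝ) : ℂ) • (E : 𝔸)‖ ≤ |r| :=
  norm_liftY_le (fun _ : Unit => r) E ()

end LiftAlgebra

/-! ## §2 The flat calculus on lifts: def-Y's covariant differences at `U = 1` versus [4]'s matrices -/

section FlatCalculus

/-- **the transposed periodic forward difference on vectors**: `(∂_μᵀ f)(z) = f(z − e_μ) − f(z)` (`S_{−e_μ} = S_{e_μ}ᵀ`).
[cite: Balaban1984PropagatorsII, (2.67) p.234 (the entry G′∇*λ; bookkeeping)] -/
theorem dT_transpose_mulVec (N : Fin (d + 1) → ℕ) (μ : Fin (d + 1)) (f : ↥(B4Reflection242.boxDom N) → ℝ) (z : ↥(B4Reflection242.boxDom N)) :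
    ((dT N μ)ᵀ *ᵥ f) z = f (tshift N (-unitVec μ) z) - f z := by
  show ((shiftMat N (unitVec μ) - 1)ᵀ *ᵥ f) z = _
  rw [Matrix.transpose_sub, Matrix.transpose_one, ← shiftMat_neg, Matrix.sub_mulVec, Pi.sub_apply, shiftMat_mulVec,
    Matrix.one_mulVec]

/-- **`−Δ_T = Σ_μ ∂_μᵀ∂_μ` on vectors** (T1's `perLapT` versus T6's `dT`). [cite: Balaban1983RegularityDecay, (1.3) p.572 (periodic Laplacian; bookkeeping)] -/
theorem perLapT_mulVec_eq_sum_dT (N : Fin (d + 1) → ℕ) (f : ↥(B4Reflection242.boxDom N) → ℝ) (z : ↥(B4Reflection242.boxDom N)) :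
    (perLapT N *ᵥ f) z = ∑ μ : Fin (d + 1), ((dT N μ)ᵀ *ᵥ (dT N μ *ᵥ f)) z := by
  rw [perLapT_mulVec]
  refine Finset.sum_congr rfl fun μ _ => ?_
  rw [dT_transpose_mulVec, dT_mulVec, dT_mulVec, tshift_tshift, neg_add_cancel, tshift_zero]
  ring

variable (i : KIdx d ℓ hd hL b₀ b₁)

/-- **`∇_{1,μ}(g ⊗ E) = (∂_μ g) ⊗ E`** — def-Y's site-sector covariant derivative at `U = 1` on a lift is the lift of T6's periodic forward
difference. [cite: Balaban1985BackgroundPropagators, (3.3) p.390 + p.395 («coincides … if U = 1»); Balaban1984PropagatorsII, (2.67) p.234] -/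
theorem cdS_one_liftY (μ : Fin (d + 1)) (g : SiteY i → ℝ) (E : 𝔸) :
    cdS i (fun _ _ => 1) μ (liftY g E) = liftY (dT (toKT i).NB μ *ᵥ g) E := by
  funext z
  rw [cdS_one, liftY_sub_apply, liftY_apply, dT_mulVec]
  rfl

/-- **`∇*_{1,μ}(g ⊗ E) = (∂_μᵀ g) ⊗ E`** — def-Y's `∇*` at `U = 1` on a lift is the lift of the transposed periodic difference.
[cite: Balaban1985BackgroundPropagators, (3.8) p.392 + p.395; Balaban1984PropagatorsII, (2.67) p.234] -/
theorem cdsS_one_liftY (μ : Fin (d + 1)) (g : SiteY i → ℝ) (E : 𝔸) :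
    cdsS i (fun _ _ => 1) μ (liftY g E) = liftY ((dT (toKT i).NB μ)ᵀ *ᵥ g) E := by
  funext z
  rw [cdsS_one, liftY_sub_apply, liftY_apply, dT_transpose_mulVec]
  show (((g ((tshift (toKT i).NB (unitVec μ)).symm z) - g z : ℝ)) : ℂ) • E = _
  rw [tshift_symm_apply]

/-- **`Δ_1(g ⊗ E) = (−Δ_T g) ⊗ E`** — def-Y's site-sector covariant Laplacian at `U = 1` on a lift is the lift of T1's periodic Laplacian
(p. 395: *"It coincides with Δ_a in (2.19) if U = 1"*, Laplacian part). [cite: Balaban1985BackgroundPropagators, (3.23) p.395; Balaban1984PropagatorsII, (2.67) p.234 (entry ΔG′λ)] -/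
theorem lapS_one_liftY (g : SiteY i → ℝ) (E : 𝔸) :
    lapS i (fun _ _ => 1) (liftY g E) = liftY (perLapT (toKT i).NB *ᵥ g) E := by
  funext z
  simp only [lapS, cdS_one_liftY, cdsS_one_liftY, liftY_apply]
  rw [← Finset.sum_smul, perLapT_mulVec_eq_sum_dT, Complex.ofReal_sum]

end FlatCalculus

/-! ## §3 At a site-sector letter with the printed `U = 1` clause: every reading at `U = 1` is dominated by [4]'s functional -/

section Letter

variable (i : KIdx d ℓ hd hL b₀ b₁) (O : SiteOpY 𝔸 i)
  (hO : ∀ (f : SiteY i → ℝ) (E : 𝔸), O (fun _ _ => 1) (liftY f E) = liftY ((toKT i).G *ᵥ f) E)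
include hO

/-- **(3.42)₁ at `U = 1` vs (2.67)₁**: `sup_{z ∈ Δ(s)} ‖(G′(1)(f ⊗ E))(z)‖ ≤ sup_{z ∈ Δ(s)} |(G′f)(z)|` for `‖E‖ ≤ 1` (def-Y's `Gp_e0_one_le`, letter
form). [cite: Balaban1985BackgroundPropagators, Cor. 3.5 p.407 + (3.42) p.397; Balaban1984PropagatorsII, (2.67) p.234] -/
theorem supBlkS_one_le (f : SiteY i → ℝ) (E : BallY 𝔸) (s : BlkY i) :
    supBlkS i s (O (fun _ _ => 1) (liftY f (E : 𝔸))) ≤ (toKT i).e0 f s := by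
  rw [hO]
  unfold supBlkS KTIdx.e0
  classical
  exact iSup_ite_le_iSup_ite (X := SiteY i) _ _ _ (fun z _ => norm_liftY_le _ E z) (fun z => abs_nonneg _)

/-- **(3.42)₂ at `U = 1` vs (2.67)₂**: `sup_{z ∈ Δ(s), μ} ‖(∇_{1,μ}G′(1)(f ⊗ E))(z)‖ ≤ sup_{z ∈ Δ(s), μ} |(G′f)(z + e_μ) − (G′f)(z)|`.
[cite: Balaban1985BackgroundPropagators, Cor. 3.5 p.407 + (3.42) p.397 + (3.3) p.390; Balaban1984PropagatorsII, (2.67) p.234] -/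
theorem supBlkS'_cdS_one_le (f : SiteY i → ℝ) (E : BallY 𝔸) (s : BlkY i) :
    supBlkS' i s (fun μ => cdS i (fun _ _ => 1) μ (O (fun _ _ => 1) (liftY f (E : 𝔸)))) ≤ (toKT i).e1 f s := by
  simp only [hO, cdS_one_liftY]
  unfold supBlkS' KTIdx.e1
  classical
  refine iSup_ite_le_iSup_ite (X := SiteY i × Fin (d + 1)) _ _ _ (fun p _ => ?_) (fun p => abs_nonneg _)
  exact (norm_liftY_le _ E p.1).trans_eq (by rw [dT_mulVec])

/-- **(3.42)₃ at `U = 1` vs (2.67)₃**: `sup_{z ∈ Δ(s), μ} ‖(G′(1)∇*_{1,μ}(f ⊗ E))(z)‖ ≤ sup_{z ∈ Δ(s), μ} |(G′∂_μᵀf)(z)|`.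
[cite: Balaban1985BackgroundPropagators, Cor. 3.5 p.407 + (3.42) p.397 + (3.8) p.392; Balaban1984PropagatorsII, (2.67) p.234] -/
theorem supBlkS'_cdsS_one_le (f : SiteY i → ℝ) (E : BallY 𝔸) (s : BlkY i) :
    supBlkS' i s (fun μ => O (fun _ _ => 1) (cdsS i (fun _ _ => 1) μ (liftY f (E : 𝔸)))) ≤ (toKT i).e2 f s := by
  simp only [cdsS_one_liftY, hO, Matrix.mulVec_mulVec]
  unfold supBlkS' KTIdx.e2
  classical
  exact iSup_ite_le_iSup_ite (X := SiteY i × Fin (d + 1)) _ _ _ (fun p _ => norm_liftY_le _ E p.1) (fun p => abs_nonneg _)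

/-- **(3.42)₄ at `U = 1` vs (2.67)₆**: `sup_{z ∈ Δ(s)} ‖(Δ_1G′(1)(f ⊗ E))(z)‖ ≤ sup_{z ∈ Δ(s)} |((−Δ_T)G′f)(z)|`.
[cite: Balaban1985BackgroundPropagators, Cor. 3.5 p.407 + (3.42) p.397 + (3.23) p.395; Balaban1984PropagatorsII, (2.67) p.234] -/
theorem supBlkS_lapS_one_le (f : SiteY i → ℝ) (E : BallY 𝔸) (s : BlkY i) :
    supBlkS i s (lapS i (fun _ _ => 1) (O (fun _ _ => 1) (liftY f (E : 𝔸)))) ≤ (toKT i).e3 f s := by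
  rw [hO, lapS_one_liftY, Matrix.mulVec_mulVec]
  unfold supBlkS KTIdx.e3
  classical
  exact iSup_ite_le_iSup_ite (X := SiteY i) _ _ _ (fun z _ => norm_liftY_le _ E z) (fun z => abs_nonneg _)

/-- **ALL FOUR (3.42) READINGS AT `U = 1` ARE DOMINATED BY [4]'s (2.67) FUNCTIONALS** (lattice units; `eLatS` vs T8's `KTIdx.gp.e`).
[cite: Balaban1985BackgroundPropagators, Cor. 3.5 p.407 + (3.42) p.397; Balaban1984PropagatorsII, Prop. 2.2 (2.67) p.234] -/
theorem eLatS_one_le (f : SiteY i → ℝ) (E : BallY 𝔸) (s : BlkY i) (n : Fin 4) :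
    eLatS i O (fun _ _ => 1) (liftY f (E : 𝔸)) s n ≤ (toKT i).gp.e n f s := by
  fin_cases n
  · exact supBlkS_one_le i O hO f E s
  · exact supBlkS'_cdS_one_le i O hO f E s
  · exact supBlkS'_cdsS_one_le i O hO f E s
  · exact supBlkS_lapS_one_le i O hO f E s

omit hO in
/-- **the covariant Hölder quotient (3.40) AT TRIVIAL TRANSPORT on a lift is dominated by T11's scalar quotient** `hqTP` (print's units):
`‖(g ⊗ E)(z′) − (g ⊗ E)(z)‖ ≤ |g z′ − g z|` termwise, same denominators. [cite: Balaban1985BackgroundPropagators, (3.40) p.397 + Cor. 3.5 p.407; Balaban1984PropagatorsII, (2.67) p.234 («‖ζ‖_α»)] -/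
theorem hqS_one_liftY_le (α : ℝ) (g : SiteY i → ℝ) (E : BallY 𝔸) :
    hqS i (fun _ _ => 1) α (liftY g (E : 𝔸)) ≤ hqTP (toKT i) α g := by
  unfold hqS hqTP
  classical
  simp only [R_one]
  have hN : ∀ μ, 1 ≤ (toKT i).NB μ := fun μ => one_le_N0 (toKT i).hMh (toKT i).hP μ
  have hden : ∀ p : SiteY i × SiteY i, 0 ≤ (torusSupNorm (toKT i).NB (p.2.1 - p.1.1) / (nKT (toKT i))) ^ α :=
    fun p => Real.rpow_nonneg (div_nonneg (torusSupNorm_nonneg hN _) (Nat.cast_nonneg _)) _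
  refine iSup_ite_le_iSup_ite (X := SiteY i × SiteY i) _ _ _ (fun p _ => ?_) (fun p => div_nonneg (abs_nonneg _) (hden p))
  rw [liftY_sub_apply]
  exact div_le_div_of_nonneg_right (norm_real_smul_ball_le _ E) (hden p)

/-- **(3.43) AT `U = 1` vs (2.67)₄,₅**: with trivial transporters, def-Y's Hölder slot `hLatS` of G′(1) on a lift is dominated by T11's `hHTP` of
[4]'s G′ (both members `‖ζ∇^η_μG′λ‖_α`, `‖ζG′∇^{η*}_μλ‖_α`, same index `Fin (d+1) × Bool`). [cite: Balaban1985BackgroundPropagators, Cor. 3.5 p.407 + (3.43) p.398 + (3.40) p.397; Balaban1984PropagatorsII, Prop. 2.2 (2.67) p.234 (entries 4, 5)] -/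
theorem hLatS_one_le (par : SiteParY 𝔸 i) (hpar : ∀ z z', par (fun _ _ => 1) z z' = 1) (f : SiteY i → ℝ) (E : BallY 𝔸) (α : ℝ)
    (ζ : SiteY i → ℝ) : hLatS i O par (fun _ _ => 1) (liftY f (E : 𝔸)) α ζ ≤ hHTP (toKT i) f α ζ := by
  have hpar' : par (fun _ _ => 1) = fun _ _ => 1 := funext fun z => funext fun z' => hpar z z'
  -- the two branch functions are lifts of T11's `ζ·dGT`, `ζ·GdT`
  have hb1 : ∀ μ : Fin (d + 1), (fun z => ((ζ z * etaS i : ℝ) : ℂ) • cdS i (fun _ _ => 1) μ (O (fun _ _ => 1) (liftY f (E : 𝔸))) z) =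
      liftY (fun z => ζ z * dGT (toKT i) μ f z) (E : 𝔸) := by
    intro μ
    funext z
    rw [hO, cdS_one_liftY, real_smul_liftY_apply, liftY_apply, liftY_apply, dT_mulVec]
    unfold dGT etaS
    push_cast
    ring_nf
  have hb2 : ∀ μ : Fin (d + 1), (fun z => ((ζ z * etaS i : ℝ) : ℂ) • O (fun _ _ => 1) (cdsS i (fun _ _ => 1) μ (liftY f (E : 𝔸))) z) =
      liftY (fun z => ζ z * GdT (toKT i) μ f z) (E : 𝔸) := by
    intro μ
    funext z
    rw [cdsS_one_liftY, hO, Matrix.mulVec_mulVec, real_smul_liftY_apply, liftY_apply, liftY_apply]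
    unfold GdT etaS
    push_cast
    ring_nf
  unfold hLatS hHTP
  rw [hpar']
  simp only [hb1, hb2]
  classical
  haveI : Nonempty (Fin (d + 1) × Bool) := ⟨(0, true)⟩
  refine ciSup_le fun p => le_trans ?_ (le_ciSup (Set.finite_range _).bddAbove p)
  split_ifs
  · exact hqS_one_liftY_le i α _ E
  · exact hqS_one_liftY_le i α _ E

end Letter

/-! ## §4 At a member: def-Y's layer of letters meets the three `U = 1` comparisons -/

section Member

variable {G : Subgroup 𝔸ˣ} (x : MemberY d ℓ hd hL b₀ b₁ Mstar) (𝔏 : CovLettersY 𝔸 x) (𝔈 : ExpLettersY 𝔸 G x)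

/-- ★ **ROW `hGp_e` AT THE LAYER OF LETTERS, ONE MEMBER**: for EVERY letter record `𝔏` (its field `Gp_one` = p. 395's «coincides … if U = 1»), the four
(3.42) sup entries of the reading of G′(U) at `U = 1` are bounded by NODE 00's reading `GpU` of [4] Prop. 2.2's G′ — on the site summand by §3
(`η^{epow n}·sup_E eLatS ≤ η^{epow n}·gp.e`), on the bond summand both are `0`. [cite: Balaban1985BackgroundPropagators, Cor. 3.5 p.407 + (3.42) p.397; Balaban1984PropagatorsII, Prop. 2.2 (2.67) p.234] -/
theorem Gp_e_one_le (n : Fin 4) (lam : (geo9Y x).Loc) (b : (geo9Y x).Site) :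
    (operatorLayerYOfLetters 𝔸 G x 𝔏 𝔈).Gp.e n (bg9Y 𝔸 G x).one lam b ≤ (GpU x.toKIdx).e n lam b := by
  cases lam with
  | inr J => rw [Gp_e_inr, GpU_e_inr]
  | inl f =>
      show etaS x.toKIdx ^ (epow n) * (⨆ E : BallY 𝔸, eLatS x.toKIdx 𝔏.Gp (fun _ _ => 1) (liftY f (E : 𝔸)) (β x.hN x.D x.hk b) n) ≤
        ((((nKT (toKT x.toKIdx) : ℕ) : ℝ))⁻¹) ^ (epow n) * (toKT x.toKIdx).gp.e n f (β x.hN x.D x.hk b)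
      exact mul_le_mul_of_nonneg_left
        (iSup_ball_le (fun E => eLatS_one_le x.toKIdx 𝔏.Gp 𝔏.Gp_one f E _ n) (gp_e_nonneg_T8 _ n f _))
        (pow_nonneg (inv_nonneg.2 (Nat.cast_nonneg _)) _)

/-- ★ **ROW `hGp_h1` AT THE LAYER OF LETTERS, ONE MEMBER**: for EVERY `𝔏` (fields `Gp_one`, `parS_one`), the (3.43) Hölder slot of the reading of
G′(U) at `U = 1` is bounded by NODE 00's `GpU.h1` (= T11's `hHTP` on (site argument, site cut-off); `0` elsewhere on both sides).
[cite: Balaban1985BackgroundPropagators, Cor. 3.5 p.407 + (3.43) p.398; Balaban1984PropagatorsII, Prop. 2.2 (2.67) p.234 (entries 4, 5)] -/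
theorem Gp_h1_one_le (lam : (geo9Y x).Loc) (α : ℝ) (ζ : (geo9Y x).Cut) :
    (operatorLayerYOfLetters 𝔸 G x 𝔏 𝔈).Gp.h1 (bg9Y 𝔸 G x).one lam α ζ ≤ (GpU x.toKIdx).h1 lam α ζ := by
  cases lam with
  | inr J => cases ζ <;> exact (GpU_h1_inr x.toKIdx J α _).symm.le
  | inl f =>
      cases ζ with
      | inr z => exact (GpU_h1_inl_inr x.toKIdx f α z).symm.le
      | inl z =>
          show (⨆ E : BallY 𝔸, hLatS x.toKIdx 𝔏.Gp 𝔏.parS (fun _ _ => 1) (liftY f (E : 𝔸)) α z) ≤ hHTP (toKT x.toKIdx) f α z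
          exact iSup_ball_le (fun E => hLatS_one_le x.toKIdx 𝔏.Gp 𝔏.Gp_one 𝔏.parS 𝔏.parS_one f E α z) (hHTP_nonneg _ f α z)

/-- the (3.48) kernel reading is `≥ 0` at every `U` (a sup of norms over the unit ball).
[cite: Balaban1985BackgroundPropagators, Thm 3.2 (3.48) p.398 (the reading; bookkeeping)] -/
theorem Cinv_ker_nonneg (U : (bg9Y 𝔸 G x).Cfg) (b b' : (geo9Y x).Site) : 0 ≤ (operatorLayerYOfLetters 𝔸 G x 𝔏 𝔈).Cinv.ker U b b' :=
  Real.iSup_nonneg fun _ => norm_nonneg _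

/-- ★ **ROW `hC` AT THE LAYER OF LETTERS, ONE MEMBER (unsigned form)**: for EVERY `𝔏` (field `C_one`: C(1) on `δ_{s′} ⊗ E` is `CinvTP(s, s′) • E`), the
(3.48) kernel reading at `U = 1` is bounded by the absolute value of NODE 00's `CinvU` (T8's print-unit kernel of [4]'s (Q′G′²Q′*)⁻¹ at the carrier
blocks). [cite: Balaban1985BackgroundPropagators, Cor. 3.5 p.407 + Thm 3.2 (3.48) p.398; Balaban1984PropagatorsII, Prop. 2.3 (2.86)–(2.87) p.238] -/
theorem Cinv_ker_one_le_abs (b b' : (geo9Y x).Site) :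
    (operatorLayerYOfLetters 𝔸 G x 𝔏 𝔈).Cinv.ker (bg9Y 𝔸 G x).one b b' ≤ |(CinvU x.toKIdx).ker b b'| := by
  show (⨆ E : BallY 𝔸, ‖𝔏.C (fun _ _ => 1) (deltaY (β x.hN x.D x.hk b') (E : 𝔸)) (β x.hN x.D x.hk b)‖) ≤
    |(CinvTP (toKT x.toKIdx)).ker (β x.hN x.D x.hk b) (β x.hN x.D x.hk b')|
  exact iSup_ball_le (fun E => by rw [𝔏.C_one]; exact norm_real_smul_ball_le _ E) (abs_nonneg _)

/-- ★ **ROW `hC` AT THE LAYER OF LETTERS, ONE MEMBER** — the binder's shape `|C.ker 1 y y′| ≤ |CinvU.ker y y′|`.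
[cite: Balaban1985BackgroundPropagators, Cor. 3.5 p.407 + Thm 3.2 (3.48) p.398; Balaban1984PropagatorsII, Prop. 2.3 (2.86)–(2.87) p.238] -/
theorem Cinv_ker_one_abs_le (b b' : (geo9Y x).Site) :
    |(operatorLayerYOfLetters 𝔸 G x 𝔏 𝔈).Cinv.ker (bg9Y 𝔸 G x).one b b'| ≤ |(CinvU x.toKIdx).ker b b'| := by
  rw [abs_of_nonneg (Cinv_ker_nonneg x 𝔏 𝔈 _ b b')]
  exact Cinv_ker_one_le_abs x 𝔏 𝔈 b b'

end Member

/-! ## §5 At the record: the knit binders `hGp_e`, `hGp_h1`, `hC` at `ops := opsYOfLetters N θ M⋆ 𝔏 𝔈` -/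

section Record

open scoped Matrix.Norms.L2Operator

variable (N : ℕ) (θ : Stage3Params) (Mstar' : ℕ) (𝔏 : LettersY N θ Mstar') (𝔈 : ExpsY N θ Mstar')

/-- ★★ **THE KNIT BINDER `hGp_e` AT NODE 00's OPERATOR LAYER OF LETTERS** — for EVERY family of letter records `𝔏` and expansion letters `𝔈`:
at `ops := opsYOfLetters N θ M⋆ 𝔏 𝔈` the `U = 1` comparison of the four (3.42) sup entries of G′(1) against `Node00.GpU` holds at every member —
LITERALLY the binder `hGp_e` of `Summit.…b9_main_of_up_view₁₁B10YZW_of_obligations` ∕ `B9PinCarriersKLevelV1.b9LeafX_carriersY` at that `ops`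
(Cor. 3.5: *"For operators with the external gauge field configuration U = 1, these theorems are proved in [4]"*, at the level of readings).
[cite: Balaban1985BackgroundPropagators, Cor. 3.5 p.407 + (3.42) p.397; Balaban1984PropagatorsII, Prop. 2.2 (2.67) p.234] -/
theorem hGp_e_opsYOfLetters :
    ∀ (x : MemberY θ.d₆ θ.ℓ₆ θ.hd' θ.hL' θ.b₀ θ.b₁ Mstar') (n : Fin 4) (lam : (geo9Y x).Loc) (y : (geo9Y x).Site),
      (opsYOfLetters N θ Mstar' 𝔏 𝔈 x).Gp.e n (bg9Y (Matrix (Fin N) (Fin N) ℂ) (specialUnitaryUnits (Fin N)) x).one lam y ≤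
        (Node00.GpU x.toKIdx).e n lam y :=
  fun x => Gp_e_one_le x (𝔏 x) (𝔈 x)

/-- ★★ **THE KNIT BINDER `hGp_h1` AT NODE 00's OPERATOR LAYER OF LETTERS** — LITERALLY `hGp_h1` at `ops := opsYOfLetters N θ M⋆ 𝔏 𝔈`, every `𝔏`, `𝔈`.
[cite: Balaban1985BackgroundPropagators, Cor. 3.5 p.407 + (3.43) p.398; Balaban1984PropagatorsII, Prop. 2.2 (2.67) p.234 (entries 4, 5)] -/
theorem hGp_h1_opsYOfLetters :
    ∀ (x : MemberY θ.d₆ θ.ℓ₆ θ.hd' θ.hL' θ.b₀ θ.b₁ Mstar') (lam : (geo9Y x).Loc) (b : ℝ) (c : (geo9Y x).Cut),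
      (opsYOfLetters N θ Mstar' 𝔏 𝔈 x).Gp.h1 (bg9Y (Matrix (Fin N) (Fin N) ℂ) (specialUnitaryUnits (Fin N)) x).one lam b c ≤
        (Node00.GpU x.toKIdx).h1 lam b c :=
  fun x => Gp_h1_one_le x (𝔏 x) (𝔈 x)

/-- ★★ **THE KNIT BINDER `hC` AT NODE 00's OPERATOR LAYER OF LETTERS** — LITERALLY `hC` at `ops := opsYOfLetters N θ M⋆ 𝔏 𝔈`, every `𝔏`, `𝔈`.
[cite: Balaban1985BackgroundPropagators, Cor. 3.5 p.407 + Thm 3.2 (3.48) p.398; Balaban1984PropagatorsII, Prop. 2.3 (2.86)–(2.87) p.238] -/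
theorem hC_opsYOfLetters :
    ∀ (x : MemberY θ.d₆ θ.ℓ₆ θ.hd' θ.hL' θ.b₀ θ.b₁ Mstar') (y y' : (geo9Y x).Site),
      |(opsYOfLetters N θ Mstar' 𝔏 𝔈 x).Cinv.ker (bg9Y (Matrix (Fin N) (Fin N) ℂ) (specialUnitaryUnits (Fin N)) x).one y y'| ≤
        |(Node00.CinvU x.toKIdx).ker y y'| :=
  fun x => Cinv_ker_one_abs_le x (𝔏 x) (𝔈 x)

end Record

end Literature.MathematicalPhysics.QuantumFieldTheory.Balaban1983to89.B9Cor35ComparisonsGpCAtLetters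

end
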